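import Summits.Ventures.CertifiedManyBodySolver.Observables.StiffnessTLOddMomentIdentification
import Summits.Ventures.CertifiedManyBodySolver.Rows.DopedTLCorr
import HarnessLib

/-!
# Ventures/CertifiedManyBodySolver — Observables: the odd-moment (Krylov-3) stiffness row `R-K3-TL`
# as a `D₄`-ORBIT-MEAN window row — the shape in which the cell's reduced window relaxations certify

HONEST FRAMING: one-sided CEILINGS on the flux stiffness (helicity modulus / superfluid weight); not
a superconductivity verdict; no stiffness floor follows from equal-time data and an energy window.

Cell `hubbard-obs` (D-0042), seat p2 (stiffness). The (translation × `D₄` × spin-flip × SU(2) ×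
conjugation)-REDUCED window programs of the cell (EXT5-L⁺, K8, A4⁺) certify ORBIT-MEAN rows
`r ≤ |S|⁻¹ Σ_{γ∈S} Re ω_{γΛ}(Γ(d4Emb γ 0 Λ) X)` on the torus-limit ground-state class
(`Rows/DopedTLCorr.SquareTTPrimeCorrOrbitLowerRow`). This file puts the UNCONDITIONAL `R-K3-TL` adapter of
`StiffnessTLOddMomentIdentification.lean` into exactly that shape:

* `oddMomentObs U λ = X_λ = ½ k₀ + λ d₁ − (λ²/2) m₃' ∈ 𝔄_{[-7,7]²}` — ONE window observable with
  `Re ω(X_λ) = oddMomentLimitFunctional U λ ω` (`re_expect_oddMomentObs`);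
* **`D₄` covariance of translation averages** (`torusAvgExpect_d4Emb_eq`): the translation average of the
  rotated observable `Γ(d4Emb γ 0 Λ) A` in `ψ` is the translation average of `A` in `U_{γ⁻¹} ψ`
  (`U_γ = fockD4 γ`); since `U_{γ⁻¹}` maps unit sector ground states to unit sector ground states
  (`relabel_d4Perm_hubbardTorus`), the finite-volume odd-moment ceiling applied to `U_{γ⁻¹} ψ` reads
  `ρ_s ≤ Re(avg of Γ(d4Emb γ 0 Λ₇) X_λ in ψ)` for EVERY `γ ∈ D₄` (`rotOddMomentFunctional_eq_torusAvgExpect`);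
* **`fluxStiffness_le_of_torusLimit_oddMoment_orbit_certificate`**: for a nonempty `S ⊆ D₄`, a certificate
  `|S|⁻¹ Σ_{γ∈S} Re ω_{γΛ₇}(Γ(d4Emb γ 0 Λ₇) X_λ) ≤ q` on the torus-limit ground-state class gives `ρ_s ≤ q`;
* **`fluxStiffness_le_of_oddMoment_orbitLowerRow_neg`**: the cell's row cell
  `SquareTTPrimeCorrOrbitLowerRow 0 U (1−δ) u r S Λ₇ (−X_λ)` (LOWER row on the NEGATED word = the
  "up"-edge pattern of the registry) together with the energy cap `e(U, 1−δ, 0) ≤ u` gives `ρ_s ≤ −r`;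
  `m3_tp0_fluxStiffness_le_of_oddMoment_orbitLowerRow_neg` is the M3′ instance (`U = 8`, `n = 7/8`,
  `M3CorrOrbitLowerRow 0 u r S (box 2 7) (−oddMomentObs 8 λ)`), i.e. the Lean cell a certified `stiffK3`
  edge (`HOME/BURST-INPUTS-obs.md`, registry id `OBS.rhosK3.tp0.TLext5Lp`) plugs into.

References: [Kohn1964]; [ScalapinoWhiteZhang1993] §II; [Lipparini2008] eq. (8.30); [Scalapino1995] §2
(point group); [BratteliRobinsonII1997] §5.2.2, Thm. 5.2.5; [BratteliRobinsonI1987] §4.3.1.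
-/

noncomputable section

namespace Summit.Ventures.CertifiedManyBodySolver.Observables

open Matrix Finset Filter Topology
open Literature.MathematicalPhysics.QuantumLattice
open Literature.MathematicalPhysics.QuantumLattice.ThermodynamicLimit
open Literature.MathematicalPhysics.QuantumFieldTheory
open Literature.Probability.LatticeModels
open scoped ComplexOrder ComplexConjugate Topology

/-! ### The single window observable `X_λ` -/

/-- The **window observable of the row at fixed `λ`**: `X_λ = ½ k₀ + λ d₁ − (λ²/2) m₃' ∈ 𝔄_{[-7,7]²}`
(`k₀`, `d₁` included from their boxes). [cite: Lipparini2008, eq. (8.30)] -/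
def oddMomentObs (U lam : ℝ) : FermionOp (box 2 7) :=
  (((1 / 2 : ℝ) : ℂ) • fermionEmbed (PolySite.incl (box_subset_box (by norm_num))) kinBondObs +
      ((lam : ℝ) : ℂ) • fermionEmbed (PolySite.incl (box_subset_box (by norm_num))) (firstMomentObs U)) -
    ((lam ^ 2 / 2 : ℝ) : ℂ) • thirdMomentObs U

/-- `Re ω(X_λ) = F_λ(ω) = ½Re ω(k₀) + λ Re ω(d₁) − (λ²/2) Re ω(m₃')` (compatibility of the local
expectations along isotony). [cite: Lipparini2008, eq. (8.30)] -/
theorem re_expect_oddMomentObs (U lam : ℝ) (ω : InfVolFermionState 2) :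
    (ω.expect (box 2 7) (oddMomentObs U lam)).re = oddMomentLimitFunctional U lam ω := by
  unfold oddMomentObs oddMomentLimitFunctional
  rw [map_sub, map_add, map_smul, map_smul, map_smul, ω.compatible, ω.compatible, smul_eq_mul, smul_eq_mul,
    smul_eq_mul, Complex.sub_re, Complex.add_re, Complex.re_ofReal_mul, Complex.re_ofReal_mul,
    Complex.re_ofReal_mul]
  ring

/-! ### Linearity and isotony of translation averages -/

section Finite

variable (L : ℕ) [NeZero L]

/-- Translation averages are additive in the observable. [folklore] -/
theorem torusAvgExpectAt_add' {d : ℕ} {Λ : Finset (Site d)} (hΛ : Set.InjOn (Torus.proj (d := d) L) ↑Λ)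
    (A B : FermionOp Λ) (ψ : Fock (Orb (FermionTorus d L))) :
    torusAvgExpectAt L Λ (A + B) ψ = torusAvgExpectAt L Λ A ψ + torusAvgExpectAt L Λ B ψ := by
  rw [torusAvgExpectAt_of_injOn L hΛ, torusAvgExpectAt_of_injOn L hΛ, torusAvgExpectAt_of_injOn L hΛ,
    ← mul_add, ← Finset.sum_add_distrib]
  congr 1
  refine Finset.sum_congr rfl fun v _ => ?_
  rw [fermionEmbed_add, Literature.MathematicalPhysics.QuantumLattice.expect, Literature.MathematicalPhysics.QuantumLattice.expect,
    Literature.MathematicalPhysics.QuantumLattice.expect, Matrix.add_mulVec, dotProduct_add]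

/-- Translation averages are homogeneous in the observable. [folklore] -/
theorem torusAvgExpectAt_smul' {d : ℕ} {Λ : Finset (Site d)} (hΛ : Set.InjOn (Torus.proj (d := d) L) ↑Λ)
    (c : ℂ) (A : FermionOp Λ) (ψ : Fock (Orb (FermionTorus d L))) :
    torusAvgExpectAt L Λ (c • A) ψ = c * torusAvgExpectAt L Λ A ψ := by
  have hsm : ∀ (X : Matrix (Finset (Orb (FermionTorus d L))) (Finset (Orb (FermionTorus d L))) ℂ)
      (φ : Fock (Orb (FermionTorus d L))),
      Literature.MathematicalPhysics.QuantumLattice.expect (c • X) φ = c * Literature.MathematicalPhysics.QuantumLattice.expect X φ := by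
    intro X φ
    rw [Literature.MathematicalPhysics.QuantumLattice.expect, Literature.MathematicalPhysics.QuantumLattice.expect,
      Matrix.smul_mulVec, dotProduct_smul, smul_eq_mul]
  rw [torusAvgExpectAt_of_injOn L hΛ, torusAvgExpectAt_of_injOn L hΛ, fermionEmbed_smul]
  simp_rw [hsm]
  rw [← Finset.mul_sum]
  ring

/-- Translation averages are subtractive in the observable. [folklore] -/
theorem torusAvgExpectAt_sub' {d : ℕ} {Λ : Finset (Site d)} (hΛ : Set.InjOn (Torus.proj (d := d) L) ↑Λ)
    (A B : FermionOp Λ) (ψ : Fock (Orb (FermionTorus d L))) :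
    torusAvgExpectAt L Λ (A - B) ψ = torusAvgExpectAt L Λ A ψ - torusAvgExpectAt L Λ B ψ := by
  rw [torusAvgExpectAt_of_injOn L hΛ, torusAvgExpectAt_of_injOn L hΛ, torusAvgExpectAt_of_injOn L hΛ,
    ← mul_sub, ← Finset.sum_sub_distrib]
  congr 1
  refine Finset.sum_congr rfl fun v _ => ?_
  rw [fermionEmbed_sub, Literature.MathematicalPhysics.QuantumLattice.expect, Literature.MathematicalPhysics.QuantumLattice.expect,
    Literature.MathematicalPhysics.QuantumLattice.expect, Matrix.sub_mulVec, dotProduct_sub]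

/-- **Isotony**: the translation average of `Γ(incl) A ∈ 𝔄_{Λ'}` is that of `A ∈ 𝔄_Λ`. [folklore] -/
theorem torusAvgExpectAt_incl {d : ℕ} {Λ Λ' : Finset (Site d)} (hΛ : Λ ⊆ Λ')
    (h' : Set.InjOn (Torus.proj (d := d) L) ↑Λ') (A : FermionOp Λ) (ψ : Fock (Orb (FermionTorus d L))) :
    torusAvgExpectAt L Λ' (fermionEmbed (PolySite.incl hΛ) A) ψ = torusAvgExpectAt L Λ A ψ := by
  rw [torusAvgExpectAt_of_injOn L h', torusAvgExpectAt_of_injOn L (h'.mono (Finset.coe_subset.2 hΛ)),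
    fermionEmbed_toTorusEmb_incl]

/-- The translation average of `X_λ` is the combination of the three averages. [cite: Lipparini2008, eq. (8.30)] -/
theorem torusAvgExpectAt_oddMomentObs (U lam : ℝ) (h7 : Set.InjOn (Torus.proj (d := 2) L) ↑(box 2 7))
    (ψ : Fock (Orb (FermionTorus 2 L))) :
    torusAvgExpectAt L (box 2 7) (oddMomentObs U lam) ψ =
      ((1 / 2 : ℝ) : ℂ) * torusAvgExpectAt L (box 2 1) kinBondObs ψ +
        ((lam : ℝ) : ℂ) * torusAvgExpectAt L (box 2 4) (firstMomentObs U) ψ -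
        ((lam ^ 2 / 2 : ℝ) : ℂ) * torusAvgExpectAt L (box 2 7) (thirdMomentObs U) ψ := by
  unfold oddMomentObs
  rw [torusAvgExpectAt_sub' L h7, torusAvgExpectAt_add' L h7, torusAvgExpectAt_smul' L h7,
    torusAvgExpectAt_smul' L h7, torusAvgExpectAt_smul' L h7, torusAvgExpectAt_incl L _ h7,
    torusAvgExpectAt_incl L _ h7]

/-- `⟨φ, (U_π X U_πᴴ) φ⟩ = ⟨U_π⁻¹ φ, X U_π⁻¹ φ⟩`. [cite: BratteliRobinsonII1997, §5.2.2, Thm. 5.2.5] -/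
theorem expect_relabel_eq_expect_fockRelabel_inv_mulVec {ι : Type*} [LinearOrder ι] [Fintype ι]
    (π : Equiv.Perm ι) (X : Matrix (Finset ι) (Finset ι) ℂ) (φ : Fock ι) :
    Literature.MathematicalPhysics.QuantumLattice.expect (relabel π X) φ =
      Literature.MathematicalPhysics.QuantumLattice.expect X ((fockRelabel π⁻¹).val *ᵥ φ) := by
  have h := expect_fockRelabel_mulVec π⁻¹ X φ
  rw [Equiv.Perm.inv_def, Equiv.symm_symm] at h
  rw [Equiv.Perm.inv_def]
  exact h.symm

/-! ### `D₄` covariance of translation averages -/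

/-- **`D₄` covariance of translation averages**: for a region `Λ` fitting into the torus, `γ ∈ D₄`,
`A ∈ 𝔄_Λ` and a torus vector `ψ`, the translation average of the rotated observable
`Γ(d4Emb γ 0 Λ) A ∈ 𝔄_{γΛ}` in `ψ` equals the translation average of `A` in `U_{γ⁻¹} ψ`
(`Γ(ι_{γΛ}) Γ(d4Emb γ 0) A = D_γ (Γ(ι_Λ) A) D_γᴴ`, `fermionEmbed_toTorusEmb_d4Emb`; `D_γ U_v = U_{γv} D_γ`;
reindex the average by `v ↦ γ⁻¹ v`). [cite: BratteliRobinsonII1997, §5.2.2, Thm. 5.2.5] -/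
theorem torusAvgExpect_d4Emb_eq (γ : DihedralGroup 4) {Λ : Finset (Site 2)}
    (hΛ : Set.InjOn (Torus.proj (d := 2) L) ↑Λ) (A : FermionOp Λ) (ψ : Fock (Orb (FermionTorus 2 L))) :
    torusAvgExpect L (d4ShiftSet γ 0 Λ) (fermionEmbed (PolySite.d4Emb γ 0 Λ) A) ψ =
      torusAvgExpect L Λ A ((fockD4 (L := L) γ⁻¹).val *ᵥ ψ) := by
  have hγ : Set.InjOn (Torus.proj (d := 2) L) ↑(d4ShiftSet γ 0 Λ) := (injOn_proj_d4ShiftSet_iff L γ 0 Λ).2 hΛ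
  have hproj0 : Torus.proj L (0 : Site 2) = 0 := by funext i; simp [Torus.proj]
  have hinv : (Orb.d4Perm (L := L) γ)⁻¹ = Orb.d4Perm γ⁻¹ := (map_inv (Orb.d4Perm (L := L)) γ).symm
  have hstep : ∀ v : TorusSite 2 L,
      Literature.MathematicalPhysics.QuantumLattice.expect
          (relabel (Orb.d4Perm γ) (fermionEmbed (PolySite.toTorusEmb L hΛ) A)) ((fockTranslate v).val *ᵥ ψ) =
        Literature.MathematicalPhysics.QuantumLattice.expect (fermionEmbed (PolySite.toTorusEmb L hΛ) A)
          ((fockTranslate (d4Site γ⁻¹ v)).val *ᵥ ((fockD4 (L := L) γ⁻¹).val *ᵥ ψ)) := by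
    intro v
    rw [expect_relabel_eq_expect_fockRelabel_inv_mulVec, hinv, ← fockD4_apply, mulVec_mulVec,
      fockD4_val_mul_fockTranslate_val γ⁻¹ v, ← mulVec_mulVec]
  have hre : ∑ v : TorusSite 2 L, Literature.MathematicalPhysics.QuantumLattice.expect
        (fermionEmbed (PolySite.toTorusEmb L hΛ) A)
        ((fockTranslate (d4Site γ⁻¹ v)).val *ᵥ ((fockD4 (L := L) γ⁻¹).val *ᵥ ψ)) =
      ∑ u : TorusSite 2 L, Literature.MathematicalPhysics.QuantumLattice.expect
        (fermionEmbed (PolySite.toTorusEmb L hΛ) A) ((fockTranslate u).val *ᵥ ((fockD4 (L := L) γ⁻¹).val *ᵥ ψ)) :=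
    Fintype.sum_equiv (d4SitePerm (L := L) γ⁻¹) _ _ fun v => rfl
  rw [torusAvgExpect_eq, torusAvgExpect_eq, torusAvgExpectAt_of_injOn L hγ, torusAvgExpectAt_of_injOn L hΛ,
    fermionEmbed_toTorusEmb_d4Emb γ 0 hΛ hγ A, hproj0, Orb.translate_zero, Equiv.Perm.one_def, relabel_refl,
    Finset.sum_congr rfl fun v _ => hstep v, hre]

/-- `U_{γ⁻¹}` maps sector ground states of the square Hubbard torus to sector ground states
(`D_γ H D_γᴴ = H`). [cite: Scalapino1995, §2] -/
theorem isGroundStateInSector_fockD4_inv_mulVec (U : ℝ) (γ : DihedralGroup 4) {N : ℕ} {M : ℝ}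
    {ψ : Fock (Orb (FermionTorus 2 L))} (hgs : IsGroundStateInSector (hubbardTorus 2 L 1 U) N M ψ) :
    IsGroundStateInSector (hubbardTorus 2 L 1 U) N M ((fockD4 (L := L) γ⁻¹).val *ᵥ ψ) :=
  hgs.fockD4_mulVec γ⁻¹ (relabel_d4Perm_hubbardTorus γ⁻¹ 1 U)

/-- `U_{γ⁻¹}` preserves the norm. [folklore] -/
theorem star_fockD4_inv_mulVec_dotProduct (γ : DihedralGroup 4) (ψ : Fock (Orb (FermionTorus 2 L))) :
    star ((fockD4 (L := L) γ⁻¹).val *ᵥ ψ) ⬝ᵥ ((fockD4 (L := L) γ⁻¹).val *ᵥ ψ) = star ψ ⬝ᵥ ψ := by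
  rw [fockD4_apply]
  exact star_fockRelabel_mulVec_dotProduct _ ψ

end Finite

/-! ### The rotated per-side functional and its identification -/

/-- The per-side odd-moment functional evaluated in the rotated vector `U_{γ⁻¹} ψ`.
[cite: Lipparini2008, eq. (8.30)] -/
def rotOddMomentFunctional (U δ lam : ℝ) (γ : DihedralGroup 4) (L : ℕ)
    (ψ : Fock (Orb (FermionTorus 2 L))) : ℝ :=
  if hL : L = 0 then 0 else
    haveI : NeZero L := ⟨hL⟩
    oddMomentFunctional U δ lam L ((fockD4 (L := L) γ⁻¹).val *ᵥ ψ)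

/-- At a side `L ≠ 0` (junk value `0` at `L = 0`). [cite: Lipparini2008, eq. (8.30)] -/
theorem rotOddMomentFunctional_eq (U δ lam : ℝ) (γ : DihedralGroup 4) (L : ℕ) [NeZero L]
    (ψ : Fock (Orb (FermionTorus 2 L))) :
    rotOddMomentFunctional U δ lam γ L ψ = oddMomentFunctional U δ lam L ((fockD4 (L := L) γ⁻¹).val *ᵥ ψ) := by
  rw [rotOddMomentFunctional, dif_neg (NeZero.ne L)]

/-- The limit functional of the rotated copy: `Re ω_{γΛ₇}(Γ(d4Emb γ 0 Λ₇) X_λ)`, `Λ₇ = [-7,7]²`.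
[cite: Lipparini2008, eq. (8.30)] -/
def rotOddMomentLimitFunctional (U lam : ℝ) (γ : DihedralGroup 4) (ω : InfVolFermionState 2) : ℝ :=
  (ω.expect (d4ShiftSet γ 0 (box 2 7)) (fermionEmbed (PolySite.d4Emb γ 0 (box 2 7)) (oddMomentObs U lam))).re

section Finite

variable (L : ℕ) [NeZero L]

/-- **The rotated functional is the translation average of the ROTATED window observable**
(`L ≥ 15`): for every sector ground state `ψ` of `hubbardTorus 2 L 1 U`,
`rotOddMomentFunctional U δ λ γ L ψ = Re(avg of Γ(d4Emb γ 0 Λ₇) X_λ in ψ)` — the identification of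
`StiffnessTLOddMomentIdentification.lean` in the ground state `U_{γ⁻¹}ψ`, then `D₄` covariance.
[cite: BratteliRobinsonII1997, §5.2.2, Thm. 5.2.5] -/
theorem rotOddMomentFunctional_eq_torusAvgExpect (U δ lam : ℝ) (γ : DihedralGroup 4) (hL : 15 ≤ L)
    {ψ : Fock (Orb (FermionTorus 2 L))}
    (hgs : IsGroundStateInSector (hubbardTorus 2 L 1 U) (2 * ⌊(1 - δ) * (L : ℝ) ^ 2 / 2⌋₊) 0 ψ) :
    rotOddMomentFunctional U δ lam γ L ψ =
      (torusAvgExpect L (d4ShiftSet γ 0 (box 2 7))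
        (fermionEmbed (PolySite.d4Emb γ 0 (box 2 7)) (oddMomentObs U lam)) ψ).re := by
  have h7 : Set.InjOn (Torus.proj (d := 2) L) ↑(box 2 7) := injOn_proj_box (by omega)
  rw [rotOddMomentFunctional_eq, oddMomentFunctional_eq_torusAvgExpect L U δ lam hL (isGroundStateInSector_fockD4_inv_mulVec L U γ hgs),
    torusAvgExpect_d4Emb_eq L γ h7, torusAvgExpect_eq, torusAvgExpect_eq, torusAvgExpect_eq, torusAvgExpect_eq,
    torusAvgExpectAt_oddMomentObs L U lam h7, Complex.sub_re, Complex.add_re, Complex.re_ofReal_mul,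
    Complex.re_ofReal_mul, Complex.re_ofReal_mul]
  ring

/-- **The odd-moment ceiling in every rotated copy** (`L ≥ 15`): for a flux stiffness `ρ_s` at side `L`
and every unit sector ground state `ψ`, `ρ_s ≤ rotOddMomentFunctional U δ λ γ L ψ` for every `γ ∈ D₄`
(the finite-volume ceiling `fluxStiffness_mul_sq_le_kinetic_add_oddMoments` in the unit ground state
`U_{γ⁻¹}ψ`). [cite: Kohn1964] -/
theorem fluxStiffness_le_rotOddMomentFunctional (hL : 3 ≤ L) {U δ ρs θ₀ : ℝ} (hθ₀ : 0 < θ₀)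
    (hst : ∀ θ : ℝ, |θ| ≤ θ₀ → ρs * θ ^ 2 ≤ fluxEnergy L U δ θ - fluxEnergy L U δ 0)
    {ψ : Fock (Orb (FermionTorus 2 L))}
    (hgs : IsGroundStateInSector (hubbardTorus 2 L 1 U) (2 * ⌊(1 - δ) * (L : ℝ) ^ 2 / 2⌋₊) 0 ψ)
    (h1 : star ψ ⬝ᵥ ψ = 1) (lam : ℝ) (γ : DihedralGroup 4) :
    ρs ≤ rotOddMomentFunctional U δ lam γ L ψ := by
  have hfin := fluxStiffness_mul_sq_le_kinetic_add_oddMoments hL hθ₀ hst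
    (isGroundStateInSector_fockD4_inv_mulVec L U γ hgs) (by rw [star_fockD4_inv_mulVec_dotProduct, h1]) lam
  have hLpos : (0 : ℝ) < (L : ℝ) ^ 2 := by
    have : (0 : ℝ) < (L : ℝ) := Nat.cast_pos.2 (NeZero.pos L)
    positivity
  rw [rotOddMomentFunctional_eq, oddMomentFunctional_eq, le_div_iff₀ hLpos]
  exact hfin

end Finite

/-! ### The orbit-mean adapter -/

/-- **`R-K3-TL` as a `D₄`-orbit-mean row.** Let `δ ≥ −1`, `λ ∈ ℝ`, `S ⊆ D₄` nonempty, and let `ρ_s, θ₀ > 0` be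
a uniform flux stiffness of the zero-flux `(N_L, S^z = 0)` sectors of `hubbardTorus 2 L 1 U` along all even
`L ≥ L₀`. If a certificate gives `|S|⁻¹ Σ_{γ∈S} Re ω_{γΛ₇}(Γ(d4Emb γ 0 Λ₇) X_λ) ≤ q` (`X_λ = oddMomentObs U λ`,
`Λ₇ = [-7,7]²`) for EVERY torus limit `ω` of unit sector ground states along sides `Ls → ∞`, then `ρ_s ≤ q`:
the generic adapter `fluxStiffness_le_of_torusLimit_functional_row` with the orbit mean of the rotated
per-side functionals (each `≥ ρ_s` by `fluxStiffness_le_rotOddMomentFunctional`, each converging by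
`rotOddMomentFunctional_eq_torusAvgExpect` and weak-⋆ convergence). [cite: ScalapinoWhiteZhang1993, §II] -/
theorem fluxStiffness_le_of_torusLimit_oddMoment_orbit_certificate {U δ ρs θ₀ q : ℝ} (lam : ℝ)
    (S : Finset (DihedralGroup 4)) (hS : S.Nonempty) (hδ : -1 ≤ δ) (hθ₀ : 0 < θ₀) {L₀ : ℕ}
    (hst : ∀ (L : ℕ) [NeZero L], L₀ ≤ L → Even L →
      ∀ θ : ℝ, |θ| ≤ θ₀ → ρs * θ ^ 2 ≤ fluxEnergy L U δ θ - fluxEnergy L U δ 0)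
    (hrow : ∀ (ω : InfVolFermionState 2) (Ls : ℕ → ℕ) (ψ : ∀ L, Fock (Orb (FermionTorus 2 L))),
      Tendsto Ls atTop atTop →
      (∀ j, IsGroundStateInSector (hubbardTorus 2 (Ls j) 1 U) (rectN (1 - δ) (Ls j)) 0 (ψ (Ls j))) →
      (∀ j, star (ψ (Ls j)) ⬝ᵥ ψ (Ls j) = 1) → ω.IsTorusLimitOf ψ Ls →
        (S.card : ℝ)⁻¹ * ∑ γ ∈ S, rotOddMomentLimitFunctional U lam γ ω ≤ q) :
    ρs ≤ q := by
  have hcard : (0 : ℝ) < (S.card : ℝ) := Nat.cast_pos.2 (Finset.card_pos.2 hS)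
  refine fluxStiffness_le_of_torusLimit_functional_row hδ (L₀ := L₀)
    (fun L ψ => (S.card : ℝ)⁻¹ * ∑ γ ∈ S, rotOddMomentFunctional U δ lam γ L ψ)
    (fun ω => (S.card : ℝ)⁻¹ * ∑ γ ∈ S, rotOddMomentLimitFunctional U lam γ ω) ?_ ?_ hrow
  · -- finite volume: each rotated functional is `≥ ρ_s`, hence so is their mean
    intro L _ hL0 hL3 hEven ψ hgs h1
    have hsum : ∑ _γ ∈ S, ρs ≤ ∑ γ ∈ S, rotOddMomentFunctional U δ lam γ L ψ :=
      Finset.sum_le_sum fun γ _ =>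
        fluxStiffness_le_rotOddMomentFunctional L hL3 hθ₀ (hst L hL0 hEven) hgs h1 lam γ
    rw [Finset.sum_const, nsmul_eq_mul] at hsum
    rw [inv_mul_eq_div, le_div_iff₀ hcard]
    linarith
  · -- convergence along torus-limit ground-state sequences
    intro ω Ls ψ hLs hgs h1 hω
    refine Tendsto.const_mul _ (tendsto_finsetSum _ fun γ _ => ?_)
    have hlim : Tendsto (fun j => (torusAvgExpect (Ls j) (d4ShiftSet γ 0 (box 2 7))
        (fermionEmbed (PolySite.d4Emb γ 0 (box 2 7)) (oddMomentObs U lam)) (ψ (Ls j))).re) atTop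
        (𝓝 (rotOddMomentLimitFunctional U lam γ ω)) :=
      (Complex.continuous_re.tendsto _).comp (hω _ _)
    refine hlim.congr' ?_
    filter_upwards [hLs.eventually_ge_atTop 15] with j hj
    haveI : NeZero (Ls j) := ⟨by omega⟩
    exact (rotOddMomentFunctional_eq_torusAvgExpect (Ls j) U δ lam γ hj (hgs j)).symm

/-- **The registry shape: a LOWER orbit row on the NEGATED word is a stiffness CEILING.** If the cell
`SquareTTPrimeCorrOrbitLowerRow 0 U (1−δ) u r S Λ₇ (−X_λ)` holds (for every torus-limit ground state of
`hubbardTorusTT' L 1 0 U` at density `1−δ` with energy density `≤ u`: `r ≤ |S|⁻¹Σ_γ Re ω_{γΛ₇}(Γ_γ(−X_λ))`),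
`S` is nonempty and the energy cap `e(U, 1−δ, 0) ≤ u` is certified, then every uniform flux stiffness obeys
`ρ_s ≤ −r` (tree units). [cite: ScalapinoWhiteZhang1993, §II] -/
theorem fluxStiffness_le_of_oddMoment_orbitLowerRow_neg {U δ ρs θ₀ : ℝ} (lam : ℝ) {u r : ℚ}
    (S : Finset (DihedralGroup 4)) (hS : S.Nonempty) (hδ : -1 ≤ δ) (hθ₀ : 0 < θ₀) {L₀ : ℕ}
    (hst : ∀ (L : ℕ) [NeZero L], L₀ ≤ L → Even L →
      ∀ θ : ℝ, |θ| ≤ θ₀ → ρs * θ ^ 2 ≤ fluxEnergy L U δ θ - fluxEnergy L U δ 0)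
    (hrow : SquareTTPrimeCorrOrbitLowerRow 0 U (1 - δ) u r S (box 2 7) (-oddMomentObs U lam))
    (hu : energyDensityTT' 1 0 U (1 - δ) ≤ ((u : ℚ) : ℝ)) :
    ρs ≤ -((r : ℚ) : ℝ) := by
  refine fluxStiffness_le_of_torusLimit_oddMoment_orbit_certificate lam S hS hδ hθ₀ hst
    fun ω Ls ψ hLs hgs h1 hω => ?_
  have h := hrow ω Ls ψ hLs (fun j => by simpa only [hubbardTorusTT'_zero] using hgs j) h1 hω hu
  have hneg : ∀ γ : DihedralGroup 4,
      (ω.expect (d4ShiftSet γ 0 (box 2 7)) (fermionEmbed (PolySite.d4Emb γ 0 (box 2 7)) (-oddMomentObs U lam))).re =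
        -rotOddMomentLimitFunctional U lam γ ω := fun γ => by
    rw [rotOddMomentLimitFunctional, map_neg, map_neg, Complex.neg_re]
  simp only [hneg, Finset.sum_neg_distrib, mul_neg] at h
  linarith

/-- **M3′ instance (`U = 8`, `n = 7/8`, `t' = 0`): the Lean cell for a certified `stiffK3` edge.** If the
registry-shaped row `M3CorrOrbitLowerRow 0 u r S (box 2 7) (−oddMomentObs 8 λ)` holds (`S` nonempty) and the
energy cap `e₀(8, 7/8, 0) ≤ u` is certified (node #354), then every uniform flux stiffness `ρ_s > 0` (scale
`θ₀ > 0`, all even `L ≥ L₀`) of the zero-flux `(N_L, 0)` sectors of `hubbardTorus 2 L 1 8` at density `7/8`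
satisfies `ρ_s ≤ −r` (tree units; `D_s^{HVR} ≤ −r/2`, `D^{SWZ}/(πe²) ≤ −2r`). HONEST FRAMING: one-sided
ceiling; not a superconductivity verdict. [cite: ScalapinoWhiteZhang1993, §II] -/
theorem m3_tp0_fluxStiffness_le_of_oddMoment_orbitLowerRow_neg (lam : ℝ) {u r : ℚ}
    (S : Finset (DihedralGroup 4)) (hS : S.Nonempty)
    (hrow : M3CorrOrbitLowerRow 0 u r S (box 2 7) (-oddMomentObs 8 lam))
    (hu : energyDensityTT' 1 0 8 (7 / 8) ≤ ((u : ℚ) : ℝ)) :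
    ∀ (ρs θ₀ : ℝ), 0 < θ₀ → ∀ L₀ : ℕ,
      (∀ (L : ℕ) [NeZero L], L₀ ≤ L → Even L →
        ∀ θ : ℝ, |θ| ≤ θ₀ → ρs * θ ^ 2 ≤ fluxEnergy L 8 (1 / 8) θ - fluxEnergy L 8 (1 / 8) 0) →
      ρs ≤ -((r : ℚ) : ℝ) := by
  intro ρs θ₀ hθ₀ L₀ hst
  have hrow' : SquareTTPrimeCorrOrbitLowerRow 0 8 (1 - 1 / 8) u r S (box 2 7) (-oddMomentObs 8 lam) := by
    rw [show (1 - 1 / 8 : ℝ) = 7 / 8 by norm_num]; exact hrow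
  have hu' : energyDensityTT' 1 0 8 (1 - 1 / 8) ≤ ((u : ℚ) : ℝ) := by
    rw [show (1 - 1 / 8 : ℝ) = 7 / 8 by norm_num]; exact hu
  exact fluxStiffness_le_of_oddMoment_orbitLowerRow_neg lam S hS (by norm_num) hθ₀ hst hrow' hu'

end Summit.Ventures.CertifiedManyBodySolver.Observables

end
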